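import Mathlib
import Summits.CriticalPhenomena.CardyFormulaZ2.Theorems.CardySelfRefinementDefs
import Summits.CriticalPhenomena.CardyFormulaZ2.Theorems.CardySelfRefinementRussoDriftPolynomial
import Literature.Probability.Percolation.PivotalCell
import HarnessLib

/-!
# Boundary block count for polygonal quad families (stub `stub_boundaryRelevance`, line
`far-field-is-a-quarter-turn`, crux `TrivialSectorRate`, stmt-CriticalPhenomena-10266)

The `(Dη)^b` branch of the boundary relevance hypothesis (HB) sums the relevance of the lattice
`D`-boxes over the blocks `u` within plane distance `2Dη` of the quad boundaries
(`bdist k m F η u < 2Dη`).  For an ARBITRARY topological quad that set of blocks is uncontrolled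
(fractal or positive-area boundaries); for POLYGONAL quads — the boundary of each carrier a finite
union of segments, the regularity class proposed for the corrected stub — it is a thin tube, and
this file proves the deterministic count (the hypothesis `hcount` of
`boundaryRelevance_small_of_count_of_decay`, no probability):

* `card_filter_dist_lt_le` — at spacing `s' > 0`, the sites `u ∈ ℤ²` drawn at `s'(u₀ + iu₁)` in an
  open disc of radius `ρ` number `≤ (2ρ/s' + 1)²` (both coordinates are integers of an open
  interval of length `2ρ/s'`);
* `card_filter_infDist_segment_lt_le` — those within distance `t` of a segment `[a, b]` number
  `≤ (‖b − a‖/t + 2)(4t/s' + 1)²` (cover the segment by `⌊‖b−a‖/t⌋₊ + 2` discs of radius `2t`);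
* `frontier_range_nonempty` — a quad has nonempty boundary (`ℂ` is connected and not compact);
* `card_filter_bdist_lt_le_of_polygonal` (registered helper) — **for `k ≥ 1`, `m ≥ 1` and a
  polygonal family `F` there is `L = L_F` with `#{u ∈ U : bdist k m F η u < 2Dη} ≤ L·D·(D + η⁻¹)`
  for all `η > 0`, `D ≥ 1` and finite `U`** (`L = 81 Σ_segments (‖b − a‖ + 2)`; the drawn block
  centres form the lattice `η√2k·ℤ²`, spacing `≥ η`);
* `boundaryCount_of_polygonal` — the same in the shape of `hcount`: `≤ 2L·D·η⁻¹` when `Dη < 1`.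
-/

noncomputable section

namespace Summit.CriticalPhenomena.CardyFormulaZ2.Theorems.CardySelfRefinement.FarField

open scoped Topology
open Filter Set MeasureTheory
open Literature.Probability.LatticeModels Literature.Probability.Percolation
open Literature.Probability.Percolation.QuadCrossing
open Summit.CriticalPhenomena.CardyFormulaZ2.Theses.CardySelfRefinement

/-! ## Lattice points in discs and near segments -/

/-- The integers of the open real interval `(α - β, α + β)` (`β ≥ 0`) number at most `2β + 1`. -/
theorem card_Ioo_floor_ceil_le (α β : ℝ) (hβ : 0 ≤ β) :
    ((Finset.Ioo ⌊α - β⌋ ⌈α + β⌉).card : ℝ) ≤ 2 * β + 1 := by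
  rw [Int.card_Ioo]
  have h1 : (⌈α + β⌉ : ℝ) < α + β + 1 := Int.ceil_lt_add_one _
  have h2 : α - β - 1 < (⌊α - β⌋ : ℝ) := Int.sub_one_lt_floor _
  have h3 : ((⌈α + β⌉ - ⌊α - β⌋ - 1 : ℤ) : ℝ) < 2 * β + 1 := by
    push_cast
    linarith
  have key : (((⌈α + β⌉ - ⌊α - β⌋ - 1).toNat : ℤ) : ℝ) ≤ 2 * β + 1 := by
    rw [Int.toNat_eq_max]
    push_cast
    exact max_le (by push_cast at h3; exact h3.le) (by linarith)
  exact_mod_cast key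

/-- An integer `n` with `|s' n - x| < ρ` (`s' > 0`) lies in `(x/s' - ρ/s', x/s' + ρ/s')`. -/
theorem mem_Ioo_of_abs_lt {s' ρ x : ℝ} {n : ℤ} (hs : 0 < s') (h : |s' * (n : ℝ) - x| < ρ) :
    n ∈ Finset.Ioo ⌊x / s' - ρ / s'⌋ ⌈x / s' + ρ / s'⌉ := by
  rw [abs_lt] at h
  have hlo : x / s' - ρ / s' < n := by
    rw [← sub_div, div_lt_iff₀ hs]
    linarith
  have hhi : (n : ℝ) < x / s' + ρ / s' := by
    rw [← add_div, lt_div_iff₀ hs]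
    linarith
  rw [Finset.mem_Ioo]
  constructor
  · have : (⌊x / s' - ρ / s'⌋ : ℝ) < n := (Int.floor_le _).trans_lt hlo
    exact_mod_cast this
  · have : (n : ℝ) < ⌈x / s' + ρ / s'⌉ := hhi.trans_le (Int.le_ceil _)
    exact_mod_cast this

/-- **Lattice points in a disc.**  At spacing `s' > 0` (site `u` drawn at `s'(u₀ + i u₁)`), the
sites of `U` drawn in the open disc `B(c, ρ)` number at most `(2ρ/s' + 1)²`. -/
theorem card_filter_dist_lt_le {s' : ℝ} (hs : 0 < s') {ρ : ℝ} (hρ : 0 ≤ ρ) (c : ℂ)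
    (U : Finset (Site 2)) :
    ((U.filter (fun u => dist ((s' : ℂ) * Site.toComplex u) c < ρ)).card : ℝ) ≤
      (2 * (ρ / s') + 1) ^ 2 := by
  have hβ0 : 0 ≤ ρ / s' := div_nonneg hρ hs.le
  set I₀ : Finset ℤ := Finset.Ioo ⌊c.re / s' - ρ / s'⌋ ⌈c.re / s' + ρ / s'⌉ with hI₀
  set I₁ : Finset ℤ := Finset.Ioo ⌊c.im / s' - ρ / s'⌋ ⌈c.im / s' + ρ / s'⌉ with hI₁
  have hmem : ∀ u ∈ U.filter (fun u => dist ((s' : ℂ) * Site.toComplex u) c < ρ),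
      (fun u : Site 2 => (u 0, u 1)) u ∈ I₀ ×ˢ I₁ := by
    intro u hu
    have hd : ‖(s' : ℂ) * Site.toComplex u - c‖ < ρ := by
      rw [← dist_eq_norm]
      exact (Finset.mem_filter.1 hu).2
    have hre : ((s' : ℂ) * Site.toComplex u - c).re = s' * (u 0 : ℝ) - c.re := by
      simp [Complex.mul_re]
    have him : ((s' : ℂ) * Site.toComplex u - c).im = s' * (u 1 : ℝ) - c.im := by
      simp [Complex.mul_im]
    have h0 : |s' * (u 0 : ℝ) - c.re| < ρ := hre ▸ (Complex.abs_re_le_norm _).trans_lt hd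
    have h1 : |s' * (u 1 : ℝ) - c.im| < ρ := him ▸ (Complex.abs_im_le_norm _).trans_lt hd
    exact Finset.mem_product.2 ⟨mem_Ioo_of_abs_lt hs h0, mem_Ioo_of_abs_lt hs h1⟩
  have hinj : Set.InjOn (fun u : Site 2 => (u 0, u 1))
      ↑(U.filter (fun u => dist ((s' : ℂ) * Site.toComplex u) c < ρ)) := by
    intro u _ v _ huv
    simp only [Prod.mk.injEq] at huv
    funext i
    fin_cases i
    · exact huv.1
    · exact huv.2
  have hcard := Finset.card_le_card_of_injOn _ hmem hinj
  rw [Finset.card_product] at hcard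
  have h0 := card_Ioo_floor_ceil_le (c.re / s') (ρ / s') hβ0
  have h1 := card_Ioo_floor_ceil_le (c.im / s') (ρ / s') hβ0
  calc ((U.filter (fun u => dist ((s' : ℂ) * Site.toComplex u) c < ρ)).card : ℝ)
      ≤ ((I₀.card * I₁.card : ℕ) : ℝ) := by exact_mod_cast hcard
    _ = (I₀.card : ℝ) * I₁.card := by push_cast; ring
    _ ≤ (2 * (ρ / s') + 1) * (2 * (ρ / s') + 1) :=
        mul_le_mul h0 h1 (by positivity) (by positivity)
    _ = (2 * (ρ / s') + 1) ^ 2 := by ring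

/-- **Lattice points near a segment.**  At spacing `s' > 0`, the sites of `U` drawn within distance
`t > 0` of the segment `[a, b]` number at most `(‖b − a‖/t + 2)·(2(2t/s') + 1)²`: the segment is
covered by the `N + 1` points `a + (j/N)(b − a)`, `N = ⌊‖b−a‖/t⌋₊ + 1`, at mutual distance `≤ t`,
so a point within `t` of the segment is within `2t` of one of them (`card_filter_dist_lt_le`). -/
theorem card_filter_infDist_segment_lt_le {s' t : ℝ} (hs : 0 < s') (ht : 0 < t) (a b : ℂ)
    (U : Finset (Site 2)) :
    ((U.filter (fun u =>
        Metric.infDist ((s' : ℂ) * Site.toComplex u) (segment ℝ a b) < t)).card : ℝ) ≤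
      (‖b - a‖ / t + 2) * (2 * (2 * t / s') + 1) ^ 2 := by
  classical
  set N : ℕ := ⌊‖b - a‖ / t⌋₊ + 1 with hN
  have hN0 : (0 : ℝ) < N := by positivity
  have hNge : ‖b - a‖ / t ≤ N := by
    have := Nat.lt_floor_add_one (‖b - a‖ / t)
    rw [hN]; push_cast; exact this.le
  have hNle : (N : ℝ) ≤ ‖b - a‖ / t + 1 := by
    rw [hN]; push_cast
    linarith [Nat.floor_le (div_nonneg (norm_nonneg (b - a)) ht.le)]
  -- the covering centres
  set cj : ℕ → ℂ := fun j => a + ((j : ℝ) / N) • (b - a) with hcj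
  set P : Site 2 → Prop := fun u =>
    Metric.infDist ((s' : ℂ) * Site.toComplex u) (segment ℝ a b) < t with hP
  have hcover : U.filter P ⊆ (Finset.range (N + 1)).biUnion
      (fun j => U.filter (fun u => dist ((s' : ℂ) * Site.toComplex u) (cj j) < 2 * t)) := by
    intro u hu
    obtain ⟨huU, h⟩ := Finset.mem_filter.1 hu
    have hne : (segment ℝ a b).Nonempty := ⟨a, left_mem_segment ℝ a b⟩
    obtain ⟨y, hy, hdy⟩ := (Metric.infDist_lt_iff hne).1 h
    rw [segment_eq_image'] at hy
    obtain ⟨θ, ⟨hθ0, hθ1⟩, rfl⟩ := hy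
    set j : ℕ := ⌊θ * N⌋₊ with hj
    have hθN : 0 ≤ θ * N := by positivity
    have hj1 : (j : ℝ) ≤ θ * N := Nat.floor_le hθN
    have hj2 : θ * N < j + 1 := Nat.lt_floor_add_one _
    have hjN : j ≤ N := by
      have : (j : ℝ) ≤ N := hj1.trans (by nlinarith)
      exact_mod_cast this
    refine Finset.mem_biUnion.2 ⟨j, Finset.mem_range.2 (by omega), Finset.mem_filter.2 ⟨huU, ?_⟩⟩
    -- distance from `y` to the centre `cj j`
    have hyc : dist (a + θ • (b - a)) (cj j) ≤ t := by
      rw [dist_eq_norm]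
      have : a + θ • (b - a) - cj j = (θ - (j : ℝ) / N) • (b - a) := by
        simp only [hcj, sub_smul]
        abel
      rw [this, norm_smul, Real.norm_eq_abs]
      have habs : |θ - (j : ℝ) / N| ≤ 1 / N := by
        have heq : θ - (j : ℝ) / N = (θ * N - j) / N := by field_simp
        rw [heq, abs_of_nonneg (div_nonneg (by linarith) hN0.le)]
        exact div_le_div_of_nonneg_right (by linarith) hN0.le
      calc |θ - (j : ℝ) / N| * ‖b - a‖ ≤ 1 / N * ‖b - a‖ :=
            mul_le_mul_of_nonneg_right habs (norm_nonneg _)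
        _ = ‖b - a‖ / t * t / N := by field_simp
        _ ≤ N * t / N := by gcongr
        _ = t := by field_simp
    calc dist ((s' : ℂ) * Site.toComplex u) (cj j)
        ≤ dist ((s' : ℂ) * Site.toComplex u) (a + θ • (b - a)) + dist (a + θ • (b - a)) (cj j) :=
          dist_triangle _ _ _
      _ < t + t := add_lt_add_of_lt_of_le hdy hyc
      _ = 2 * t := by ring
  calc ((U.filter P).card : ℝ)
      ≤ (((Finset.range (N + 1)).biUnion
          (fun j => U.filter (fun u => dist ((s' : ℂ) * Site.toComplex u) (cj j) < 2 * t))).card : ℝ) := by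
        exact_mod_cast Finset.card_le_card hcover
    _ ≤ ∑ j ∈ Finset.range (N + 1),
          ((U.filter (fun u => dist ((s' : ℂ) * Site.toComplex u) (cj j) < 2 * t)).card : ℝ) := by
        exact_mod_cast Finset.card_biUnion_le
    _ ≤ ∑ _j ∈ Finset.range (N + 1), (2 * (2 * t / s') + 1) ^ 2 :=
        Finset.sum_le_sum fun j _ => card_filter_dist_lt_le hs (by positivity) (cj j) U
    _ = ((N : ℝ) + 1) * (2 * (2 * t / s') + 1) ^ 2 := by
        rw [Finset.sum_const, Finset.card_range, nsmul_eq_mul]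
        push_cast
        ring
    _ ≤ (‖b - a‖ / t + 2) * (2 * (2 * t / s') + 1) ^ 2 :=
        mul_le_mul_of_nonneg_right (by linarith) (by positivity)

/-! ## Quads have nonempty boundary -/

/-- The carrier of a quad has nonempty topological boundary (`ℂ` is connected and not compact). -/
theorem frontier_range_nonempty (Q : Quad (univ : Set ℂ)) : (frontier (Set.range Q)).Nonempty := by
  rw [Set.nonempty_iff_ne_empty]
  intro h
  have hclopen : IsClopen (Set.range Q) := isClopen_iff_frontier_eq_empty.2 h
  rcases isClopen_iff.1 hclopen with h0 | h1
  · exact (Set.range_nonempty Q).ne_empty h0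
  · exact noncompact_univ ℂ (h1 ▸ isCompact_range Q.continuous_toFun)

/-! ## The boundary block count -/

/-- The drawn block centre `η·z(k•u)` is the site `u` drawn at spacing `η√2k`. -/
theorem center_eq_spacing_mul (k : ℕ) (η : ℝ) (u : Site 2) :
    (η : ℂ) * squareLatticeEmbedding.z (ctr k u) =
      ((η * Real.sqrt 2 * k : ℝ) : ℂ) * Site.toComplex u := by
  apply Complex.ext <;> simp [squareLatticeEmbedding_z, ctr, Site.toComplex] <;> ring

/-- **BOUNDARY BLOCK COUNT FOR POLYGONAL FAMILIES** (registered helper of `stub_boundaryRelevance`).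
For `k ≥ 1`, `m ≥ 1` and a finite family of quads whose carriers have POLYGONAL boundaries (each
`frontier [F i]` a finite union of segments) there is `L = L_F ≥ 0` such that for all `η > 0`,
`D ≥ 1` and finite `U ⊆ ℤ²`, the blocks of `U` within plane distance `2Dη` of the quad boundaries
number at most `L · D · (D + η⁻¹)` (`L = 81 Σ_{segments} (‖b − a‖ + 2)`): a block near the union
is near one of the segments, and `card_filter_infDist_segment_lt_le` at spacing `η√2k ≥ η`,
`t = 2Dη`.  (For `m = 0` the boundary is empty, `bdist ≡ 0` and there is nothing to count: there
`Rel ≡ ∅`.) -/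
theorem card_filter_bdist_lt_le_of_polygonal {k : ℕ} (hk : 0 < k) {m : ℕ} (hm : 0 < m)
    (F : Fin m → Quad (univ : Set ℂ))
    (hF : ∀ i, ∃ S : Finset (ℂ × ℂ), frontier (Set.range (F i)) = ⋃ p ∈ S, segment ℝ p.1 p.2) :
    ∃ L : ℝ, 0 ≤ L ∧ ∀ η : ℝ, 0 < η → ∀ D : ℕ, 1 ≤ D → ∀ U : Finset (Site 2),
      ((U.filter (fun u => bdist k m F η u < 2 * D * η)).card : ℝ) ≤ L * D * ((D : ℝ) + η⁻¹) := by
  classical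
  choose S hS using hF
  set T : Finset (ℂ × ℂ) := Finset.univ.biUnion S with hT
  -- every boundary point lies on a segment of `T`
  have hbd : ∀ y ∈ quadBdry m F, ∃ p ∈ T, y ∈ segment ℝ p.1 p.2 := by
    intro y hy
    obtain ⟨i, hi⟩ := Set.mem_iUnion.1 hy
    rw [hS i] at hi
    obtain ⟨p, hp, hyp⟩ := Set.mem_iUnion₂.1 hi
    exact ⟨p, Finset.mem_biUnion.2 ⟨i, Finset.mem_univ _, hp⟩, hyp⟩
  have hne : (quadBdry m F).Nonempty := by
    obtain ⟨y, hy⟩ := frontier_range_nonempty (F ⟨0, hm⟩)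
    exact ⟨y, Set.mem_iUnion.2 ⟨⟨0, hm⟩, hy⟩⟩
  refine ⟨81 * ∑ p ∈ T, (‖p.2 - p.1‖ + 2), by positivity, fun η hη D hD U => ?_⟩
  set s' : ℝ := η * Real.sqrt 2 * k with hs'
  set t : ℝ := 2 * D * η with ht
  have hD1 : (1 : ℝ) ≤ D := by exact_mod_cast hD
  have hk1 : (1 : ℝ) ≤ k := by exact_mod_cast hk
  have ht0 : 0 < t := by positivity
  have hsqrt : (1 : ℝ) ≤ Real.sqrt 2 := by
    rw [show (1 : ℝ) = Real.sqrt 1 by simp]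
    exact Real.sqrt_le_sqrt (by norm_num)
  have hs'η : η ≤ s' := by
    have : η * 1 * 1 ≤ η * Real.sqrt 2 * k :=
      mul_le_mul (mul_le_mul_of_nonneg_left hsqrt hη.le) hk1 zero_le_one (by positivity)
    simpa [hs'] using this
  have hs'0 : 0 < s' := lt_of_lt_of_le hη hs'η
  -- the blocks near the boundary are near one of the segments
  have hsub : U.filter (fun u => bdist k m F η u < 2 * D * η) ⊆ T.biUnion (fun p =>
      U.filter (fun u => Metric.infDist ((s' : ℂ) * Site.toComplex u) (segment ℝ p.1 p.2) < t)) := by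
    intro u hu
    obtain ⟨huU, h⟩ := Finset.mem_filter.1 hu
    have h' : Metric.infDist ((s' : ℂ) * Site.toComplex u) (quadBdry m F) < t := by
      simpa [bdist, center_eq_spacing_mul, hs', ht] using h
    obtain ⟨y, hy, hdy⟩ := (Metric.infDist_lt_iff hne).1 h'
    obtain ⟨p, hp, hyp⟩ := hbd y hy
    exact Finset.mem_biUnion.2 ⟨p, hp, Finset.mem_filter.2
      ⟨huU, (Metric.infDist_le_dist_of_mem hyp).trans_lt hdy⟩⟩
  -- numerics: `2(2t/s') + 1 ≤ 9D`, `(ℓ/t + 2)(9D)² ≤ 81 (ℓ + 2) D (D + η⁻¹)`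
  have hηinv : 0 < η⁻¹ := inv_pos.2 hη
  have hfac : 2 * (2 * t / s') + 1 ≤ 9 * D := by
    have h1 : 2 * t / s' ≤ 2 * t / η := div_le_div_of_nonneg_left (by positivity) hη hs'η
    have h2 : 2 * t / η = 4 * D := by rw [ht]; field_simp; ring
    linarith
  have hseg : ∀ p ∈ T,
      ((U.filter (fun u =>
        Metric.infDist ((s' : ℂ) * Site.toComplex u) (segment ℝ p.1 p.2) < t)).card : ℝ) ≤
        81 * (‖p.2 - p.1‖ + 2) * D * ((D : ℝ) + η⁻¹) := by
    intro p _
    have hℓ := norm_nonneg (p.2 - p.1)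
    calc _ ≤ (‖p.2 - p.1‖ / t + 2) * (2 * (2 * t / s') + 1) ^ 2 :=
          card_filter_infDist_segment_lt_le hs'0 ht0 p.1 p.2 U
      _ ≤ (‖p.2 - p.1‖ / t + 2) * (9 * D) ^ 2 := by gcongr
      _ = 81 * (‖p.2 - p.1‖ * η⁻¹ * D / 2 + 2 * (D : ℝ) ^ 2) := by
          rw [ht]; field_simp; ring
      _ ≤ 81 * ((‖p.2 - p.1‖ + 2) * D * ((D : ℝ) + η⁻¹)) := by
          gcongr
          nlinarith [mul_nonneg hℓ hηinv.le, mul_nonneg (mul_nonneg hℓ hηinv.le) (zero_le_one.trans hD1),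
            mul_nonneg hℓ (mul_self_nonneg (D : ℝ)), hD1, hηinv]
      _ = 81 * (‖p.2 - p.1‖ + 2) * D * ((D : ℝ) + η⁻¹) := by ring
  calc ((U.filter (fun u => bdist k m F η u < 2 * D * η)).card : ℝ)
      ≤ ((T.biUnion (fun p => U.filter (fun u =>
          Metric.infDist ((s' : ℂ) * Site.toComplex u) (segment ℝ p.1 p.2) < t))).card : ℝ) := by
        exact_mod_cast Finset.card_le_card hsub
    _ ≤ ∑ p ∈ T, ((U.filter (fun u =>
          Metric.infDist ((s' : ℂ) * Site.toComplex u) (segment ℝ p.1 p.2) < t)).card : ℝ) := by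
        exact_mod_cast Finset.card_biUnion_le
    _ ≤ ∑ p ∈ T, 81 * (‖p.2 - p.1‖ + 2) * D * ((D : ℝ) + η⁻¹) := Finset.sum_le_sum hseg
    _ = (81 * ∑ p ∈ T, (‖p.2 - p.1‖ + 2)) * D * ((D : ℝ) + η⁻¹) := by
        rw [Finset.mul_sum, Finset.sum_mul, Finset.sum_mul]

/-- The same count in the shape of the hypothesis `hcount` of
`boundaryRelevance_small_of_count_of_decay`: at the scales `Dη < 1`, `#{u ∈ U : bdist u < 2Dη} ≤ 2L·D·η⁻¹`. -/
theorem boundaryCount_of_polygonal {k : ℕ} (hk : 0 < k) {m : ℕ} (hm : 0 < m)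
    (F : Fin m → Quad (univ : Set ℂ))
    (hF : ∀ i, ∃ S : Finset (ℂ × ℂ), frontier (Set.range (F i)) = ⋃ p ∈ S, segment ℝ p.1 p.2) :
    ∃ L η₁ : ℝ, 0 < η₁ ∧ ∀ η ∈ Set.Ioo (0 : ℝ) η₁, ∀ (D : ℕ), 1 ≤ D → (D : ℝ) * η < 1 →
      ∀ U : Finset (Site 2),
        ((U.filter (fun u => bdist k m F η u < 2 * D * η)).card : ℝ) ≤ L * D * η⁻¹ := by
  obtain ⟨L, hL0, hL⟩ := card_filter_bdist_lt_le_of_polygonal hk hm F hF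
  refine ⟨2 * L, 1, one_pos, fun η hη D hD hDη U => ?_⟩
  have hη0 : 0 < η := hη.1
  have hDle : (D : ℝ) ≤ η⁻¹ := by
    rw [le_inv_comm₀ (by exact_mod_cast (Nat.lt_of_lt_of_le Nat.zero_lt_one hD)) hη0]
    rw [inv_eq_one_div, le_div_iff₀ (by exact_mod_cast (Nat.lt_of_lt_of_le Nat.zero_lt_one hD))]
    linarith
  have hD0 : (0 : ℝ) ≤ D := by positivity
  calc ((U.filter (fun u => bdist k m F η u < 2 * D * η)).card : ℝ)
      ≤ L * D * ((D : ℝ) + η⁻¹) := hL η hη0 D hD U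
    _ ≤ L * D * (η⁻¹ + η⁻¹) := by gcongr
    _ = 2 * L * D * η⁻¹ := by ring

end Summit.CriticalPhenomena.CardyFormulaZ2.Theorems.CardySelfRefinement.FarField

end
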